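import Summits.ABC.StewartYu.PadicG3ParVK
import HarnessLib

/-!
# The `p`-adic Gen-3 parameter record v2 (corrected family `…V`) — part VL: the range headline block `XV ≤ 424(n+1)(n+2)·W⁺/log p`

Support file (plain theorems; no named facts). Continues `PadicG3ParVK`. Second half of the m = 0 HEADLINE
(spec HOME/p1/HEADLINE-V-spec.md §2): under the m = 0 context, with `W⁺ := W + log p + log(2·Amax)`,
**`XV ≤ 424·(n+1)(n+2)·W⁺/log p`**. Ingredients: `XV_le'` (VH), `G = log p/2`, `log g ≤ log p/8`,
`log LgV ≤ log(2^{27} C_bⁿ Ω p)` (VK), `log Ω ≤ n·log(2Amax)`, `log C_b ≤ 5`, and for the D₀-branch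
`LgV·g^{n−1}/(C_bⁿΩK) ≤ 265` (`gⁿ RLgV ≤ q(2^{n+25} + 2Amax + 13 log p)`, `K = p − 1 ≥ q⁴/2`, `q = e^{log p/4} ≥ 2^{12}`).
With VH/VK: `8·2ⁿ·Zp = 2^{n+6}(n+1)·XV·(g²LgV) ≤ 424·2^{n+33}·C_bⁿ·(n+1)²(n+2)·(p/log p)·Ω·W⁺`.

## References
* [Yu2013] K. Yu, Acta Math. 211 (2013) — Theorem 1 (shape of the main term).
-/

noncomputable section

open Finset Real

namespace Summit.ABC.StewartYu

namespace PadicG3Par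

variable {n : ℕ} (P : PadicG3Par n)

/-- the height-log currency of the headline: `W⁺ = W + log p + log(2 Amax)`. [cite: Yu2013, Theorem 1] -/
def Wplus : ℝ := P.W + Real.log P.p + Real.log (2 * P.Amax)

/-- at `m = 0`, `θ₀ = ½`: `G = log p/2`. [folklore] -/
theorem G_eq_half_log (hm : P.m = 0) (hθ : P.θ₀ = 1 / 2) : P.G = Real.log P.p / 2 := by
  unfold G θm; rw [hm, hθ]; push_cast; ring

/-- `1 ≤ Amax` when every `A j ≥ 1`. [folklore] -/
theorem one_le_Amax (hA1 : ∀ j, 1 ≤ P.A j) : 1 ≤ P.Amax :=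
  le_trans (hA1 ⟨0, by have := P.hn; omega⟩) (P.hAmax _)

/-- `log Ω ≤ n · log Amax` (when every `A j ≥ 1`). [folklore] -/
theorem log_Ω_le (hA1 : ∀ j, 1 ≤ P.A j) : Real.log P.Ω ≤ n * Real.log P.Amax := by
  unfold Ω
  rw [Real.log_prod fun j _ => (lt_of_lt_of_le one_pos (hA1 j)).ne']
  calc ∑ j, Real.log (P.A j) ≤ ∑ _j : Fin n, Real.log P.Amax :=
        sum_le_sum fun j _ => Real.log_le_log (lt_of_lt_of_le one_pos (hA1 j)) (P.hAmax j)
    _ = n * Real.log P.Amax := by rw [sum_const, card_univ, Fintype.card_fin]; simp [nsmul_eq_mul]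

/-- `log p ≤ W⁺`, `W ≤ W⁺`, `n·log Amax ≤ n·W⁺`, `0 ≤ log(2Amax)` (when `A j ≥ 1`). [folklore] -/
theorem Wplus_facts (hA1 : ∀ j, 1 ≤ P.A j) :
    Real.log P.p ≤ P.Wplus ∧ P.W ≤ P.Wplus ∧ Real.log P.Amax ≤ P.Wplus ∧ 0 ≤ Real.log (2 * P.Amax) := by
  have hA := P.one_le_Amax hA1
  have hW := P.hW
  have hl := P.log_p_pos
  have h2A : 0 ≤ Real.log (2 * P.Amax) := Real.log_nonneg (by linarith)
  have hlogA : Real.log P.Amax ≤ Real.log (2 * P.Amax) := Real.log_le_log (by linarith) (by linarith)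
  unfold Wplus
  exact ⟨by linarith, by linarith, by linarith, h2A⟩

/-- `log C_b ≤ 5` (`C_b = 32e ≤ 96 ≤ e⁵`). [folklore] -/
theorem log_Cb_le : Real.log Cb ≤ 5 := by
  have hCb : Cb ≤ 96 := by
    unfold Cb cM; have := Real.exp_one_lt_d9; push_cast; nlinarith
  have he : (96 : ℝ) ≤ Real.exp 5 := by
    have h1 : (2.7 : ℝ) ≤ Real.exp 1 := by have := Real.exp_one_gt_d9; linarith
    have h2 : Real.exp 5 = Real.exp 1 ^ 5 := by rw [← Real.exp_nat_mul]; norm_num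
    rw [h2]; nlinarith [pow_le_pow_left₀ (by norm_num : (0:ℝ) ≤ 2.7) h1 5]
  calc Real.log Cb ≤ Real.log (Real.exp 5) := Real.log_le_log Cb_pos (hCb.trans he)
    _ = 5 := Real.log_exp 5

/-- at the m = 0 context: **`log LgV ≤ 19 + 5n + n·W⁺ + log p`**. [folklore] -/
theorem log_LgV_le (hm : P.m = 0) (hθ : P.θ₀ = 1 / 2) (hn2 : 2 ≤ n) (hA1 : ∀ j, 1 ≤ P.A j)
    (hAmaxΩ : P.Amax ≤ 2 ^ n * P.Ω) (hNq : P.Nq = P.K) :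
    Real.log P.LgV ≤ 19 + 5 * n + n * P.Wplus + Real.log P.p := by
  have hmain := P.g_sq_LgV_le_main hm hθ hn2 hA1 hAmaxΩ hNq
  have hg1 := P.one_le_g
  have hL1 := P.one_le_LgV
  have hΩ1 := P.one_le_Ω hA1
  have hp : (2 : ℝ) ≤ P.p := P.two_le_p
  have hCb0 := Cb_pos
  obtain ⟨_, _, hAW, _⟩ := P.Wplus_facts hA1
  have hlogΩ := P.log_Ω_le hA1
  -- `LgV ≤ g² LgV ≤ 2^27 C_bⁿ Ω p`
  have h1 : (P.LgV : ℝ) ≤ 2 ^ 27 * Cb ^ n * P.Ω * P.p := by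
    have : (P.LgV : ℝ) ≤ P.g ^ 2 * P.LgV := by
      have hg2 : 1 ≤ P.g ^ 2 := one_le_pow₀ hg1
      nlinarith
    linarith
  have h2 : Real.log P.LgV ≤ Real.log (2 ^ 27 * Cb ^ n * P.Ω * P.p) := Real.log_le_log (by linarith) h1
  rw [Real.log_mul (by positivity) (by positivity), Real.log_mul (by positivity) (by positivity),
    Real.log_mul (by positivity) (by positivity), Real.log_pow, Real.log_pow] at h2
  have hl2 : Real.log 2 ≤ 7 / 10 := by have := Real.log_two_lt_d9; linarith
  have hlCb := log_Cb_le
  have hn0 : (0 : ℝ) ≤ n := by positivity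
  have h3 : (n : ℝ) * Real.log Cb ≤ 5 * n := by nlinarith
  have h4 : (n : ℝ) * Real.log P.Amax ≤ n * P.Wplus := mul_le_mul_of_nonneg_left hAW hn0
  push_cast at h2
  linarith

/-- at the m = 0 context: **the W-branch numerator `W + log g + log LgV + 3 ≤ (n+3)·W⁺`**. [folklore] -/
theorem Wnum_le (hm : P.m = 0) (hθ : P.θ₀ = 1 / 2) (hn2 : 2 ≤ n) (hA1 : ∀ j, 1 ≤ P.A j)
    (hAmaxΩ : P.Amax ≤ 2 ^ n * P.Ω) (hNq : P.Nq = P.K) :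
    P.W + Real.log P.g + Real.log P.LgV + 3 ≤ (n + 3) * P.Wplus := by
  have hL := P.log_LgV_le hm hθ hn2 hA1 hAmaxΩ hNq
  have hl16 := P.sixteen_mul_le_log_p hm hθ
  obtain ⟨hlW, hWW, _, _⟩ := P.Wplus_facts hA1
  have hg1 := P.one_le_g
  have hgl := P.g_le_log_div hm
  have hlogg : Real.log P.g ≤ Real.log P.p / 8 := by
    have h2 := Real.log_le_sub_one_of_pos (lt_of_lt_of_le one_pos hg1)
    have h3 : P.g * (4 * ((n : ℝ) + 1)) ≤ Real.log P.p := (le_div_iff₀ (by positivity)).mp hgl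
    have hn1 : (1 : ℝ) ≤ n := by exact_mod_cast P.hn
    have h4 : P.g * 8 ≤ P.g * (4 * ((n : ℝ) + 1)) := by nlinarith
    linarith
  have hn0 : (0 : ℝ) ≤ n := by positivity
  -- `W ≤ W⁺ − log p` is not needed; use `W ≤ W⁺`, `log p ≤ W⁺`, `5n + 22 ≤ log p`
  unfold Wplus at *
  nlinarith

/-- `2^{12} ≤ e^{log p/4}` at the m = 0 context (`log p ≥ 48`, `e ≥ 2`). [folklore] -/
theorem two_pow_twelve_le_q (hm : P.m = 0) (hθ : P.θ₀ = 1 / 2) (hn2 : 2 ≤ n) : (2 : ℝ) ^ 12 ≤ Real.exp (Real.log P.p / 4) := by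
  have hl16 := P.sixteen_mul_le_log_p hm hθ
  have hn1 : (2 : ℝ) ≤ n := by exact_mod_cast hn2
  have h12 : (12 : ℝ) ≤ Real.log P.p / 4 := by rw [le_div_iff₀ (by norm_num)]; nlinarith
  have he2 : (2 : ℝ) ≤ Real.exp 1 := by have := Real.add_one_le_exp (1:ℝ); linarith
  calc (2 : ℝ) ^ 12 ≤ Real.exp 1 ^ 12 := pow_le_pow_left₀ (by norm_num) he2 12
    _ = Real.exp 12 := by rw [← Real.exp_nat_mul]; norm_num
    _ ≤ Real.exp (Real.log P.p / 4) := Real.exp_le_exp.mpr h12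

/-- at the m = 0 context: **the D₀-branch ratio `LgV·g^{n−1}/(C_bⁿΩK) ≤ 265`**. [folklore] -/
theorem D0branch_le (hm : P.m = 0) (hθ : P.θ₀ = 1 / 2) (hn2 : 2 ≤ n) (hA1 : ∀ j, 1 ≤ P.A j)
    (hAmaxΩ : P.Amax ≤ 2 ^ n * P.Ω) (hNq : P.Nq = P.K) (hK₀ : (P.K₀ : ℝ) = P.p - 1) :
    (P.LgV : ℝ) * P.g ^ (n - 1) / (Cb ^ n * P.Ω * P.K) ≤ 265 := by
  have hθ' : 1 / 2 ≤ P.θ₀ := by rw [hθ]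
  have hNqK : P.Nq ≤ 2 ^ n * P.K := by
    rw [hNq]; exact Nat.le_mul_of_pos_left _ (by positivity)
  have h1 := P.g_pow_mul_LgV_le hθ' hNqK
  have hR := P.RLgV_le_log hm hθ hNq
  have hR0 := P.RLgV_nonneg
  obtain ⟨q, hqdef⟩ : ∃ q : ℝ, q = Real.exp (Real.log P.p / 4) := ⟨_, rfl⟩
  have hq : P.g ^ n ≤ q := by rw [hqdef]; exact P.g_pow_le_exp hm
  have hq4 : q ^ 4 = P.p := by rw [hqdef]; exact P.exp_log_div_four_pow
  have hlq : Real.log P.p ≤ 4 * q := by rw [hqdef]; exact P.log_p_le_four_exp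
  have hq12 : (2 : ℝ) ^ 12 ≤ q := by rw [hqdef]; exact P.two_pow_twelve_le_q hm hθ hn2
  have hq1 : (1 : ℝ) ≤ q := le_trans (by norm_num) hq12
  have hq0 : (0 : ℝ) ≤ q := by linarith
  have hg1 := P.one_le_g
  have hg0 : 0 ≤ P.g := by linarith
  have hΩ := P.one_le_Ω hA1
  have hCb0 := Cb_pos
  have hCbn : (2 : ℝ) ^ n ≤ Cb ^ n := pow_le_pow_left₀ (by norm_num) two_le_Cb n
  have h2n : (1 : ℝ) ≤ 2 ^ n := one_le_pow₀ (by norm_num)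
  have hL0 : (0 : ℝ) ≤ P.LgV := by positivity
  -- `K = K₀ = p − 1 ≥ p/2 = q⁴/2`
  have hK : (P.K : ℝ) = P.p - 1 := by
    have : (P.K : ℝ) = (P.p : ℝ) ^ P.m * P.K₀ := by unfold K; push_cast; ring
    rw [this, hm, pow_zero, one_mul, hK₀]
  have hp : (2 : ℝ) ≤ P.p := P.two_le_p
  have hKq : q ^ 4 / 2 ≤ P.K := by rw [hK, hq4]; linarith
  have hc : 0 < Cb ^ n * P.Ω * P.K := by have := P.K_pos; positivity
  -- `LgV g^{n-1} ≤ gⁿ LgV`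
  have hgg : (P.LgV : ℝ) * P.g ^ (n - 1) ≤ P.g ^ n * P.LgV := by
    have : P.g ^ (n - 1) ≤ P.g ^ n := pow_le_pow_right₀ hg1 (by omega)
    nlinarith
  rw [div_le_iff₀ hc]
  -- need: `gⁿ LgV ≤ 265 C_bⁿ Ω K`, i.e. `gⁿ RLgV ≤ C_bⁿ Ω K`
  have hA0 : 0 ≤ P.Amax := le_trans zero_le_one (P.one_le_Amax hA1)
  have hstep : P.g ^ n * P.RLgV ≤ q * (2 ^ (n + 25) + 2 * P.Amax + 13 * Real.log P.p) :=
    mul_le_mul hq hR hR0 hq0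
  -- `2^{n+25} + 2 Amax + 13 log p ≤ X (2^25 + 2) + 52 q` with `X = 2ⁿ Ω ≥ 2ⁿ ≥ 1`
  have hX0 : (0 : ℝ) ≤ 2 ^ n * P.Ω := by positivity
  have hX2 : (2 : ℝ) ^ n ≤ 2 ^ n * P.Ω := by
    have := mul_le_mul_of_nonneg_left hΩ (pow_pos (two_pos (α := ℝ)) n).le
    linarith
  have hX1 : (1 : ℝ) ≤ 2 ^ n * P.Ω := le_trans h2n hX2
  have hin : 2 ^ (n + 25) + 2 * P.Amax + 13 * Real.log P.p ≤ 2 ^ n * P.Ω * (2 ^ 25 + 2) + 52 * q := by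
    have e : (2 : ℝ) ^ (n + 25) = 2 ^ n * 2 ^ 25 := by rw [pow_add]
    have h25 := mul_le_mul_of_nonneg_right hX2 (by norm_num : (0:ℝ) ≤ 2 ^ 25)
    rw [e]; linarith
  -- `q (X (2^25+2) + 52 q) ≤ C_bⁿ Ω q⁴/2`
  have hqq : q * 2 ^ 12 ≤ q ^ 2 := by rw [sq]; exact mul_le_mul_of_nonneg_left hq12 hq0
  have hQ : (2 : ℝ) ^ 24 ≤ q ^ 2 := by
    calc (2 : ℝ) ^ 24 = (2 ^ 12) ^ 2 := by norm_num
      _ ≤ q ^ 2 := pow_le_pow_left₀ (by positivity) hq12 2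
  have hq4' : q ^ 4 = q ^ 2 * q ^ 2 := by ring
  have hpoly : q * (2 ^ 25 + 2) + 52 * q ^ 2 ≤ q ^ 4 / 2 := by
    have a : 2 ^ 12 * (q * (2 ^ 25 + 2)) ≤ (2 ^ 25 + 2) * q ^ 2 := by
      calc (2 : ℝ) ^ 12 * (q * (2 ^ 25 + 2)) = (2 ^ 25 + 2) * (q * 2 ^ 12) := by ring
        _ ≤ (2 ^ 25 + 2) * q ^ 2 := mul_le_mul_of_nonneg_left hqq (by norm_num)
    have c : (2 : ℝ) ^ 24 * q ^ 2 ≤ q ^ 2 * q ^ 2 := mul_le_mul_of_nonneg_right hQ (sq_nonneg q)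
    have key : (2 : ℝ) ^ 12 * (q * (2 ^ 25 + 2) + 52 * q ^ 2) ≤ 2 ^ 12 * (q ^ 4 / 2) := by
      rw [hq4']; norm_num at a c ⊢; nlinarith [sq_nonneg q]
    exact le_of_mul_le_mul_left key (by norm_num)
  have hfin : q * (2 ^ n * P.Ω * (2 ^ 25 + 2) + 52 * q) ≤ Cb ^ n * P.Ω * (q ^ 4 / 2) := by
    have e1 : q * (2 ^ n * P.Ω * (2 ^ 25 + 2) + 52 * q) = 2 ^ n * P.Ω * (q * (2 ^ 25 + 2)) + 52 * q ^ 2 := by ring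
    have h52 : 52 * q ^ 2 ≤ 2 ^ n * P.Ω * (52 * q ^ 2) := by
      have := mul_le_mul_of_nonneg_right hX1 (by positivity : (0:ℝ) ≤ 52 * q ^ 2); linarith
    have e2 : 2 ^ n * P.Ω * (q * (2 ^ 25 + 2)) + 2 ^ n * P.Ω * (52 * q ^ 2) =
        2 ^ n * P.Ω * (q * (2 ^ 25 + 2) + 52 * q ^ 2) := by ring
    have h3 : 2 ^ n * P.Ω * (q * (2 ^ 25 + 2) + 52 * q ^ 2) ≤ 2 ^ n * P.Ω * (q ^ 4 / 2) :=
      mul_le_mul_of_nonneg_left hpoly hX0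
    have hCΩ : 2 ^ n * P.Ω * (q ^ 4 / 2) ≤ Cb ^ n * P.Ω * (q ^ 4 / 2) := by
      have h0 : (0 : ℝ) ≤ P.Ω * (q ^ 4 / 2) := by positivity
      have := mul_le_mul_of_nonneg_right hCbn h0
      have e3 : (2 : ℝ) ^ n * P.Ω * (q ^ 4 / 2) = 2 ^ n * (P.Ω * (q ^ 4 / 2)) := by ring
      have e4 : Cb ^ n * P.Ω * (q ^ 4 / 2) = Cb ^ n * (P.Ω * (q ^ 4 / 2)) := by ring
      linarith
    linarith
  have hRK : P.g ^ n * P.RLgV ≤ Cb ^ n * P.Ω * P.K := by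
    have h0 : 0 ≤ Cb ^ n * P.Ω := by positivity
    calc P.g ^ n * P.RLgV ≤ q * (2 ^ (n + 25) + 2 * P.Amax + 13 * Real.log P.p) := hstep
      _ ≤ q * (2 ^ n * P.Ω * (2 ^ 25 + 2) + 52 * q) := mul_le_mul_of_nonneg_left hin hq0
      _ ≤ Cb ^ n * P.Ω * (q ^ 4 / 2) := hfin
      _ ≤ Cb ^ n * P.Ω * P.K := mul_le_mul_of_nonneg_left hKq h0
  linarith

/-- **THE RANGE BLOCK: `XV ≤ 424·(n+1)(n+2)·W⁺/log p`** at the m = 0 context. [cite: Yu2013, Theorem 1 (shape)] -/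
theorem XV_le_main (hm : P.m = 0) (hθ : P.θ₀ = 1 / 2) (hn2 : 2 ≤ n) (hA1 : ∀ j, 1 ≤ P.A j)
    (hAmaxΩ : P.Amax ≤ 2 ^ n * P.Ω) (hNq : P.Nq = P.K) (hK₀ : (P.K₀ : ℝ) = P.p - 1) :
    (P.XV : ℝ) ≤ 424 * (n + 1) * (n + 2) * P.Wplus / Real.log P.p := by
  have hX := P.XV_le'
  have hG := P.G_eq_half_log hm hθ
  have hnum := P.Wnum_le hm hθ hn2 hA1 hAmaxΩ hNq
  have hD := P.D0branch_le hm hθ hn2 hA1 hAmaxΩ hNq hK₀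
  obtain ⟨hlW, _, _, _⟩ := P.Wplus_facts hA1
  have hl := P.log_p_pos
  have hl16 := P.sixteen_mul_le_log_p hm hθ
  have hn0 : (0 : ℝ) ≤ n := by positivity
  have hWp0 : 0 ≤ P.Wplus := by linarith
  -- T1 ≤ 128 (n+1)(n+3) W⁺ / log p
  have hT1 : 64 * (n + 1) * (P.W + Real.log P.g + Real.log P.LgV + 3) / P.G ≤
      128 * (n + 1) * (n + 3) * P.Wplus / Real.log P.p := by
    rw [hG, div_le_div_iff₀ (by positivity) hl]
    have h0 : (0 : ℝ) ≤ 64 * (n + 1) := by positivity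
    have h1 := mul_le_mul_of_nonneg_left hnum h0
    have h2 := mul_le_mul_of_nonneg_right h1 hl.le
    have e : 128 * ((n : ℝ) + 1) * (n + 3) * P.Wplus * (Real.log P.p / 2) =
        64 * (n + 1) * ((n + 3) * P.Wplus) * Real.log P.p := by ring
    rw [e]; exact h2
  -- T2 ≤ 398 (n+1)
  have hT2 : (3 / 2) * (n + 1) * P.LgV * P.g ^ (n - 1) / (Cb ^ n * P.Ω * P.K) ≤ 398 * (n + 1) := by
    have e : (3 / 2) * (n + 1) * (P.LgV : ℝ) * P.g ^ (n - 1) / (Cb ^ n * P.Ω * P.K) =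
        (3 / 2) * (n + 1) * ((P.LgV : ℝ) * P.g ^ (n - 1) / (Cb ^ n * P.Ω * P.K)) := by ring
    rw [e]
    have := mul_le_mul_of_nonneg_left hD (by positivity : (0:ℝ) ≤ (3 / 2) * (n + 1))
    linarith
  -- constants into `W⁺/log p ≥ 1`
  have hWl : 1 ≤ P.Wplus / Real.log P.p := by rw [le_div_iff₀ hl]; linarith
  have hrest : 398 * ((n : ℝ) + 1) + 64 * (n + 1) + 2 ≤ 464 * (n + 1) * (P.Wplus / Real.log P.p) := by
    have h0 : (0 : ℝ) ≤ 464 * (n + 1) := by positivity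
    have := mul_le_mul_of_nonneg_left hWl h0
    linarith
  have e2 : 128 * ((n : ℝ) + 1) * (n + 3) * P.Wplus / Real.log P.p + 464 * (n + 1) * (P.Wplus / Real.log P.p) =
      (128 * (n + 3) + 464) * (n + 1) * (P.Wplus / Real.log P.p) := by ring
  have hcoef : (128 * ((n : ℝ) + 3) + 464) * (n + 1) ≤ 424 * (n + 1) * (n + 2) := by
    have h1 : 128 * ((n : ℝ) + 3) + 464 ≤ 424 * (n + 2) := by linarith
    have := mul_le_mul_of_nonneg_right h1 (by positivity : (0:ℝ) ≤ n + 1)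
    linarith
  have hWl0 : 0 ≤ P.Wplus / Real.log P.p := by positivity
  calc (P.XV : ℝ) ≤ 128 * (n + 1) * (n + 3) * P.Wplus / Real.log P.p + 464 * (n + 1) * (P.Wplus / Real.log P.p) := by
        linarith
    _ = (128 * (n + 3) + 464) * (n + 1) * (P.Wplus / Real.log P.p) := e2
    _ ≤ 424 * (n + 1) * (n + 2) * (P.Wplus / Real.log P.p) := mul_le_mul_of_nonneg_right hcoef hWl0
    _ = 424 * (n + 1) * (n + 2) * P.Wplus / Real.log P.p := by ring

end PadicG3Par

end Summit.ABC.StewartYu
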